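import Summits.NavierStokesRegularity.NavierStokesRegularity.Theorems.ScenarioCensusRowA7hbPlanar

/-!
# Census row A7hb (bounded horizontal-valued ancient mild flows, KNSS gauge) — part 4: shear-structured members
# are constant (B2b), B2 closed, A7hb reduced to B1 alone

Re-homed for the scenario census (typer seat; lead §6 v1.54 «part 6») from ns-idea-2's landing extract
`pub/ideators/ns-idea-2/lines/horizontal-meter/landing/HorizontalValuedAncientLiouville.lean` (LINE «horizontal-meter»
REV 6; sha16 e96b1ff5a9ad1d2e, rc 0, 0 sorry), continuing `ScenarioCensusRowA7hbPlanar` (part 3).  Lean text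
verbatim in namespace `…ScenarioCensus.HorizontalMeter` (the line's `ℝ³` notation spelled out).

Contents: `IsBoundedKNSSMild.const_of_ae_const` (a.e.-constant slices ⇒ one constant: continuity + KNSS Remark 6.1
`KNSS2009_remark61`); `integral_inner_convect_heatTest_eq_zero_of_shear` (the nonlinear integrand of the duality
identity vanishes on a horizontal shear slice — tree `integral_inner_fderiv_heatTest_apply_eq_zero_of_ae_invariant`);
**B2b `shearIsConstant` PROVED** (caloric identity, `L¹` decay of caloric solenoidal tests
`exists_integral_norm_heatTest_le_of_isDivFree`, bounded annihilator
`IsWeaklyDivFree.exists_ae_eq_const_of_norm_le_of_forall_integral_inner_eq_zero`); **B2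
`curlFreeHorizontalIsConstant_holds` PROVED**; the reduction `row_A7hb_of_B1 : VerticalVorticityVanishesBounded → Row_A7hb`.
Census keys (namespace `…Theorems.ScenarioCensus`): `row_A7hb_of_row_A1 : Row_A1 → Row_A7hb` (A7hb ⊆ A1 BY NAME),
`row_A7hb_of_B1` (A7hb ⇐ B1, hypothesis explicit).

No census value is asserted here (A7hb stays OPEN until B1 is a tree theorem; the lead books values); NS regularity
is NOT proved; no summit statement is proved by this file.
-/

set_option linter.dupNamespace false

noncomputable section

namespace Summit.NavierStokesRegularity.NavierStokesRegularity.Theorems.ScenarioCensus.HorizontalMeter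

open Set Function Filter Topology MeasureTheory
open scoped RealInnerProductSpace InnerProductSpace NNReal Laplacian
open Literature.Analysis Literature.Analysis.FluidPDE
open Summit.NavierStokesRegularity.NavierStokesRegularity

/-! ### B2b — shear-structured members of the bounded gauge class are constant (PROVED, REV 6)
The nonlinear integrand of the duality identity vanishes on a horizontal shear slice (the tree's
`integral_inner_fderiv_heatTest_apply_eq_zero_of_ae_invariant`: slices invariant along `e` annihilate
`∂ₑ` of caloric test fields), so the identity is caloric between any two times; the tree's
`L¹`-decay of caloric solenoidal tests (`exists_integral_norm_heatTest_le_of_isDivFree`) and bounded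
annihilator lemma (`IsWeaklyDivFree.exists_ae_eq_const_of_norm_le_of_forall_integral_inner_eq_zero`)
make every slice a.e. constant; continuity and KNSS Remark 6.1 finish. -/

/-- a.e.-constant slices in the gauge class are one constant (continuity + `KNSS2009_remark61`). -/
theorem IsBoundedKNSSMild.const_of_ae_const {u : ℝ → (EuclideanSpace ℝ (Fin 3)) → (EuclideanSpace ℝ (Fin 3))} (hu : IsBoundedKNSSMild u)
    (hae : ∀ t < 0, ∃ c : (EuclideanSpace ℝ (Fin 3)), u t =ᵐ[volume] fun _ => c) : ∃ b : (EuclideanSpace ℝ (Fin 3)), ∀ t < 0, ∀ x, u t x = b := by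
  have hS : IsSmoothSpaceTimeOn (Iio 0) u := hu.1
  classical
  set b' : ℝ → (EuclideanSpace ℝ (Fin 3)) := fun t => if ht : t < 0 then (hae t ht).choose else 0 with hb'
  have hub' : ∀ t < 0, ∀ x, u t x = b' t := by
    intro t ht x
    have hc : Continuous (u t) := (hS.contDiff_slice ht).continuous
    have e : u t = fun _ => (hae t ht).choose :=
      (Continuous.ae_eq_iff_eq volume hc continuous_const).1 (hae t ht).choose_spec
    simp only [hb', dif_pos ht]
    exact congrFun e x
  have hconst := KNSS2009_remark61 one_pos hub' (fun s' t' hst' ht' =>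
    Eventually.of_forall fun x => by
      rw [one_mul, hu.2.2.1 s' t' hst' ht' x, heatFlow_of_pos _ (sub_pos.2 hst')])
  exact ⟨b' (-1), fun t ht x => by rw [hub' t ht x]; exact hconst t (-1) ht (by norm_num)⟩

/-- **The nonlinear integrand vanishes on a horizontal shear slice**: for `v` continuous, bounded,
horizontal (`v·e₃ ≡ 0`) and constant on horizontal planes, `∫⟪v, (v·∇)e^{νσΔ}φ⟫ = 0` for every
test field `φ`.  Indeed `(v·∇)ψ = v₀ ∂₀ψ + v₁ ∂₁ψ` and each bounded field `vₖ v` is invariant under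
the translations along `eₖ`. -/
theorem integral_inner_convect_heatTest_eq_zero_of_shear {v : (EuclideanSpace ℝ (Fin 3)) → (EuclideanSpace ℝ (Fin 3))} (hvc : Continuous v)
    {B : ℝ} (hB : ∀ x, ‖v x‖ ≤ B) (hh : ∀ x, v x 2 = 0)
    (hshear : ∀ x y : (EuclideanSpace ℝ (Fin 3)), x 2 = y 2 → v x = v y)
    {φ : (EuclideanSpace ℝ (Fin 3)) → (EuclideanSpace ℝ (Fin 3))} (hφ : FunctionSpaces.IsTestFunctionOn (⊤ : TopologicalSpace.Opens (EuclideanSpace ℝ (Fin 3))) φ) (ν σ : ℝ) :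
    ∫ x, ⟪v x, convect v (heatTest ν φ σ) x⟫_ℝ = 0 := by
  set ψ := heatTest ν φ σ with hψ
  have hB0 : 0 ≤ B := (norm_nonneg _).trans (hB 0)
  -- horizontal decomposition of the value
  have hdec : ∀ x, v x = (v x 0) • EuclideanSpace.single (0 : Fin 3) (1 : ℝ) +
      (v x 1) • EuclideanSpace.single (1 : Fin 3) (1 : ℝ) := by
    intro x; ext i; fin_cases i <;> simp [hh x]
  -- the integrand, split along the two horizontal directions
  have hptw : ∀ x, ⟪v x, convect v ψ x⟫_ℝ =
      ⟪(v x 0) • v x, fderiv ℝ ψ x (EuclideanSpace.single 0 1)⟫_ℝ +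
        ⟪(v x 1) • v x, fderiv ℝ ψ x (EuclideanSpace.single 1 1)⟫_ℝ := by
    intro x
    have hlin : fderiv ℝ ψ x (v x) = (v x 0) • fderiv ℝ ψ x (EuclideanSpace.single 0 1) +
        (v x 1) • fderiv ℝ ψ x (EuclideanSpace.single 1 1) := by
      conv_lhs => rw [hdec x]
      simp only [map_add, map_smul]
    rw [convect_apply, hlin]
    simp only [inner_add_right, real_inner_smul_left, real_inner_smul_right]
  -- the fields `vₖ v`
  have hcomp : ∀ (k : Fin 3) x, |v x k| ≤ ‖v x‖ := fun k x => by
    have h := abs_real_inner_le_norm (v x) (EuclideanSpace.single k (1 : ℝ))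
    simpa [EuclideanSpace.inner_single_right, PiLp.norm_single] using h
  have hwb : ∀ (k : Fin 3) x, ‖(v x k) • v x‖ ≤ B * B := fun k x => by
    rw [norm_smul, Real.norm_eq_abs]
    exact mul_le_mul ((hcomp k x).trans (hB x)) (hB x) (norm_nonneg _) hB0
  have hwm : ∀ k : Fin 3, AEStronglyMeasurable (fun x => (v x k) • v x) volume := fun k =>
    (((EuclideanSpace.proj k).continuous.comp hvc).smul hvc).aestronglyMeasurable
  have hinv : ∀ k : Fin 3, k ≠ 2 → ∀ h : ℝ,
      (fun x => (v (x + h • EuclideanSpace.single k (1 : ℝ)) k) • v (x + h • EuclideanSpace.single k (1 : ℝ)))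
        =ᵐ[volume] fun x => (v x k) • v x := by
    intro k hk h
    refine Eventually.of_forall fun x => ?_
    have hx : (x + h • EuclideanSpace.single k (1 : ℝ)) 2 = x 2 := by
      simp [Ne.symm hk]
    simp only [hshear _ _ hx]
  -- integrability of the two summands
  have hφ1 : ContDiff ℝ 1 φ := hφ.contDiff.of_le (by exact_mod_cast le_top)
  have hDe_i : ∀ e : (EuclideanSpace ℝ (Fin 3)), Integrable fun x => fderiv ℝ ψ x e := by
    intro e
    have hDe_c : Continuous fun z => fderiv ℝ φ z e :=
      (hφ1.continuous_fderiv one_ne_zero).clm_apply continuous_const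
    have : Integrable (heatFlow (fun z => fderiv ℝ φ z e) (ν * σ)) :=
      integrable_heatFlow (hDe_c.integrable_of_hasCompactSupport
        (hφ.hasCompactSupport.fderiv_apply (𝕜 := ℝ) e)) _
    exact this.congr (Eventually.of_forall fun x =>
      (fderiv_heatFlow_apply hφ1 hφ.hasCompactSupport _ x e).symm)
  have hint : ∀ k : Fin 3, Integrable fun x =>
      ⟪(v x k) • v x, fderiv ℝ ψ x (EuclideanSpace.single k (1 : ℝ))⟫_ℝ := fun k =>
    integrable_inner_of_aestronglyMeasurable_of_norm_le (hwm k) (hwb k) (hDe_i _)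
  have hzero : ∀ k : Fin 3, k ≠ 2 →
      ∫ x, ⟪(v x k) • v x, fderiv ℝ ψ x (EuclideanSpace.single k (1 : ℝ))⟫_ℝ = 0 := fun k hk =>
    integral_inner_fderiv_heatTest_apply_eq_zero_of_ae_invariant (hwm k) (hwb k) (hinv k hk) hφ ν σ
  rw [integral_congr_ae (Eventually.of_forall hptw), integral_add (hint 0) (hint 1),
    hzero 0 (by decide), hzero 1 (by decide), add_zero]

/-- **B2b (PROVED)**: shear-structured members of the bounded KNSS-gauge class are constant. -/
theorem shearIsConstant : ShearIsConstant := by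
  intro u hu hh hshear
  have hA : IsBoundedAncientMildSolution 1 u := hu.isBoundedAncientMildSolution
  have hS : IsSmoothSpaceTimeOn (Iio 0) u := hu.1
  obtain ⟨B, hB⟩ := hu.2.2.2
  have hmeas : ∀ t < 0, AEStronglyMeasurable (u t) volume := fun t ht =>
    hu.aestronglyMeasurable_slice ht
  -- the nonlinear integrand vanishes on every slice
  have hN : ∀ τ < 0, ∀ {φ : (EuclideanSpace ℝ (Fin 3)) → (EuclideanSpace ℝ (Fin 3))}, FunctionSpaces.IsTestFunctionOn (⊤ : TopologicalSpace.Opens (EuclideanSpace ℝ (Fin 3))) φ →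
      ∀ σ : ℝ, ∫ x, ⟪u τ x, convect (u τ) (heatTest 1 φ σ) x⟫_ℝ = 0 := fun τ hτ φ hφ σ =>
    integral_inner_convect_heatTest_eq_zero_of_shear (hS.contDiff_slice hτ).continuous (hB τ hτ)
      (hh τ hτ) (hshear τ hτ) hφ 1 σ
  -- hence the identity is caloric between any two times
  have hcal : ∀ {s t : ℝ}, s < t → t < 0 → ∀ {φ : (EuclideanSpace ℝ (Fin 3)) → (EuclideanSpace ℝ (Fin 3))},
      FunctionSpaces.IsTestFunctionOn (⊤ : TopologicalSpace.Opens (EuclideanSpace ℝ (Fin 3))) φ → VectorCalculus.IsDivFree φ →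
      ∫ x, ⟪u t x, φ x⟫_ℝ = ∫ x, ⟪u s x, heatTest 1 φ (t - s) x⟫_ℝ := by
    intro s t hst ht φ hφ hdiv
    have key := hA.1.2 s t hst ht φ hφ hdiv
    simp only [Pi.zero_apply, inner_zero_left, integral_zero, intervalIntegral.integral_zero,
      add_zero] at key
    have hz : ∫ τ in s..t, ∫ x, ⟪u τ x, convect (u τ) (heatTest 1 φ (t - τ)) x⟫_ℝ = 0 := by
      rw [intervalIntegral.integral_congr (g := fun _ => (0 : ℝ)) ?_]
      · simp
      · intro τ hτ
        rw [uIcc_of_le hst.le] at hτ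
        exact hN τ (hτ.2.trans_lt ht) hφ (t - τ)
    rw [hz, add_zero] at key
    exact key
  -- all solenoidal pairings of each slice vanish (caloric `L¹` decay)
  have horth : ∀ t < 0, ∀ φ : (EuclideanSpace ℝ (Fin 3)) → (EuclideanSpace ℝ (Fin 3)), FunctionSpaces.IsTestFunctionOn (⊤ : TopologicalSpace.Opens (EuclideanSpace ℝ (Fin 3))) φ →
      VectorCalculus.IsDivFree φ → ∫ x, ⟪u t x, φ x⟫_ℝ = 0 := by
    intro t ht φ hφ hdiv
    obtain ⟨K, hK0, hK⟩ := exists_integral_norm_heatTest_le_of_isDivFree hφ hdiv one_pos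
    have hB0 : 0 ≤ B := (norm_nonneg _).trans (hB t ht 0)
    have hφi : Integrable φ :=
      hφ.contDiff.continuous.integrable_of_hasCompactSupport hφ.hasCompactSupport
    set a := ∫ x, ⟪u t x, φ x⟫_ℝ with ha
    have hbound : ∀ s' < t, ‖a‖ ≤ B * K * (t - s') ^ (-(1 / 2 : ℝ)) := by
      intro s' hs'
      have hs'0 : s' < 0 := hs'.trans ht
      have hts' : 0 < t - s' := by linarith
      rw [ha, hcal hs' ht hφ hdiv]
      have hψi : Integrable (heatTest 1 φ (t - s')) := integrable_heatFlow hφi _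
      calc ‖∫ x, ⟪u s' x, heatTest 1 φ (t - s') x⟫_ℝ‖
          ≤ ∫ x, B * ‖heatTest 1 φ (t - s') x‖ :=
            norm_integral_le_of_norm_le (hψi.norm.const_mul B) (Eventually.of_forall fun x =>
              (norm_inner_le_norm _ _).trans
                (mul_le_mul_of_nonneg_right (hB s' hs'0 x) (norm_nonneg _)))
        _ = B * ∫ x, ‖heatTest 1 φ (t - s') x‖ := integral_const_mul _ _
        _ ≤ B * (K * (t - s') ^ (-(1 / 2 : ℝ))) := mul_le_mul_of_nonneg_left (hK _ hts') hB0
        _ = B * K * (t - s') ^ (-(1 / 2 : ℝ)) := by ring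
    have htend : Tendsto (fun s' : ℝ => B * K * (t - s') ^ (-(1 / 2 : ℝ))) atBot (𝓝 0) := by
      have h1 : Tendsto (fun s' : ℝ => t - s') atBot atTop := by
        simpa only [sub_eq_add_neg] using
          tendsto_atTop_add_const_left atBot t tendsto_neg_atBot_atTop
      have h2 := (tendsto_rpow_neg_atTop (by norm_num : (0 : ℝ) < 1 / 2)).comp h1
      simpa using h2.const_mul (B * K)
    have hle : ‖a‖ ≤ 0 :=
      ge_of_tendsto htend (by
        filter_upwards [eventually_lt_atBot t] with s' hs' using hbound s' hs')
    exact norm_le_zero_iff.1 hle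
  have hae : ∀ t < 0, ∃ c : (EuclideanSpace ℝ (Fin 3)), u t =ᵐ[volume] fun _ => c := fun t ht =>
    IsWeaklyDivFree.exists_ae_eq_const_of_norm_le_of_forall_integral_inner_eq_zero (hmeas t ht)
      (hB t ht) (hA.1.1 t ht) (horth t ht)
  exact hu.const_of_ae_const hae


/-- **B2 (PROVED, REV 6)**. -/
theorem curlFreeHorizontalIsConstant_holds : CurlFreeHorizontalIsConstant :=
  curlFreeHorizontalIsConstant_of_shearIsConstant shearIsConstant

/-- **Rung 1b reduced to B1 alone (REV 6)**: the bounded horizontal-valued Liouville theorem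
`Row_A7hb` follows from the vanishing of the vertical vorticity in the bounded gauge class. -/
theorem row_A7hb_of_B1 (hB1 : VerticalVorticityVanishesBounded) : Row_A7hb :=
  row_A7hb_of_stubs hB1 curlFreeHorizontalIsConstant_holds

end Summit.NavierStokesRegularity.NavierStokesRegularity.Theorems.ScenarioCensus.HorizontalMeter

namespace Summit.NavierStokesRegularity.NavierStokesRegularity.Theorems.ScenarioCensus

/-- Lattice: A1 ⇒ A7hb BY NAME (`HorizontalMeter.row_A7hb_of_row_A1`: the KNSS-gauge class is a subclass of the
census duality class; a.e.-constant continuous slices are constant; KNSS Remark 6.1). -/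
theorem row_A7hb_of_row_A1 (h : Row_A1) : Row_A7hb := HorizontalMeter.row_A7hb_of_row_A1 h

/-- Reduction of census row A7hb to the single obligation B1 (`HorizontalMeter.VerticalVorticityVanishesBounded`:
bounded KNSS-gauge class, `u₃ ≡ 0` ⇒ `ω₃ ≡ 0`), B2a/B2b/B2 being tree theorems (`HorizontalMeter.row_A7hb_of_B1`). -/
theorem row_A7hb_of_B1 (hB1 : HorizontalMeter.VerticalVorticityVanishesBounded) : Row_A7hb :=
  HorizontalMeter.row_A7hb_of_B1 hB1

end Summit.NavierStokesRegularity.NavierStokesRegularity.Theorems.ScenarioCensus
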